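import Summits.BirchSwinnertonDyer.BirchSwinnertonDyer.Theorems.ManinLocalTwoThreeManinThreeKummerCube
import HarnessLib

/-!
# (BI)_K, piece P2: the `3`-adic transport of the tangent-line Kummer series, `T`-free part
(route `ManinLocalTwoThree`, crux C3 `ManinPrimeToThreeAtNine` stmt-BirchSwinnertonDyer-22968 — residual RES₃♭, -an g39's `K`-line, stub (BI)_K
`UDCKummerLineK.KummerCubeRootThreeBoundedK`; cell bsd-f2-manin, prover seat p2 gen 18; `--supports stmt-BirchSwinnertonDyer-22968`)

The proof of E-an-55 `ManinThreeKummerCube_holds` (this namespace) transports, for a globally minimal `W` with a datum at a level `9 ∣ N`,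
`3 ∣ c`, the short-model germ `z` to the `3`-integral model `E♮` (cuspidal at `3`, Honda type `p`): `c·z ↦ D₃ = [3]_{E♮}(t)` with
`t = exp_{E♮}(c′L) ∈ qℤ₃⟦q⟧` (`c = 3c′`), and reads the two `T`-INDEPENDENT formal pieces of the Kummer series on `E♮ ⊗ ℚ₃`:
`(z³y)_{E_{W,c}}(z) ↦ −x̂(D₃)`, `(z²x)_{E_{W,c}}(z) ↦ x̂(D₃)`, `z ↦ c⁻¹D₃`.  That part of the proof does not see the `3`-torsion point; this
file re-runs it VERBATIM and PACKAGES the output (`exists_threeAdic_transport`), so that the `K`-rational (BI)_K (a point `(X₀, Y₀)` with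
`Y₀ ∉ ℚ₃`) can apply p2's `kummerTripling_of_subring` over `k = ℚ₃(Y₀)` to the SAME `(E♮, t, D₃)`.

HONEST FRAMING.  Bookkeeping only (a repackaging of the tree proof's §A–§C/§G); (BI)_K, KLINE, RES₃♭, C3, Manin's conjecture and BSD are NOT
proved.  No sorry, no new axioms. [cite: Honda1970, Thm. 2 (p. 223) (type `p` at infinite height; through the tree's `exists_padicInt_shortModel_three`)]
[cite: SilvermanAEC2009, IV.1–IV.2 and IV.5.5 (formal group expansions, log/exp)]
-/

set_option autoImplicit false
-- lint-debt: the directory name repeats the summit name (sibling precedent `ManinLocalTwoThreeManinThreeKummerCube.lean`)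
set_option linter.dupNamespace false

noncomputable section

open scoped Classical MatrixGroups ModularForm
open PowerSeries CongruenceSubgroup
open WeierstrassCurve Literature.NumberTheory.EllipticCurves Literature.NumberTheory.EllipticCurves.ModularForms
  Literature.RingTheory.FormalGroups
open Summit.BirchSwinnertonDyer.Rank1Residual.ManinAdditive.CuspidalKummer
  Summit.BirchSwinnertonDyer.Rank1Residual.ManinAdditive.CuspidalKummerThree

namespace Summit.BirchSwinnertonDyer.BirchSwinnertonDyer.Theorems.ManinLocalTwoThree.KLineBI

/-- **The `3`-adic transport (T-free part of E-an-55's proof).**  For a globally minimal elliptic `W`, a datum `D` at a level `9 ∣ N` with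
`3 ∣ c`, THE germ `z`: there are a `3`-integral short model `V` of `W` over `ℤ₃` (`a₁ = a₂ = a₃ = 0`, `a₄, a₆` those of `E_{W,1}`, elliptic
generic fibre, `exp` integral) and `t ∈ qℤ₃⟦q⟧`, `t ≠ 0`, with `D₃ := [3](t) ≠ 0`, `D₃ = c·z` and
`(z³y)(z) ↦ −x̂(D₃)`, `(z²x)(z) ↦ x̂(D₃)` under `ℚ⟦q⟧ → ℚ₃⟦q⟧`. [folklore] -/
theorem exists_threeAdic_transport (W : WeierstrassCurve ℚ) [W.IsElliptic] [W.IsGloballyMinimal] {N : ℕ} [NeZero N]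
    (D : ModularParametrizationData W N) (a : ℕ → ℤ) (ha : ∀ n, (a n : ℂ) = cuspCoeff D.f n) (h9 : 9 ∣ N)
    (z : ℚ⟦X⟧) (hz : IsParamGerm W D.c a z) (h3c : (3 : ℤ) ∣ D.c) :
    ∃ (V : WeierstrassCurve ℤ_[3]) (_ : (V.map PadicInt.Coe.ringHom).IsElliptic) (t : ℚ_[3]⟦X⟧),
      (V.map PadicInt.Coe.ringHom).a₁ = 0 ∧ (V.map PadicInt.Coe.ringHom).a₂ = 0 ∧ (V.map PadicInt.Coe.ringHom).a₃ = 0 ∧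
      (V.map PadicInt.Coe.ringHom).a₄ = ((shortModel W 1).a₄ : ℚ_[3]) ∧ (V.map PadicInt.Coe.ringHom).a₆ = ((shortModel W 1).a₆ : ℚ_[3]) ∧
      constantCoeff t = 0 ∧ t ≠ 0 ∧ IsPadicInt t ∧ ((V.map PadicInt.Coe.ringHom).formalMul 3).subst t ≠ 0 ∧
      ((V.map PadicInt.Coe.ringHom).formalMul 3).subst t = C ((D.c : ℚ) : ℚ_[3]) * PowerSeries.map (algebraMap ℚ ℚ_[3]) z ∧
      PowerSeries.map (algebraMap ℚ ℚ_[3]) ((shortModel W D.c).formalXMulSq.subst z) =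
        (V.map PadicInt.Coe.ringHom).formalXMulSq.subst (((V.map PadicInt.Coe.ringHom).formalMul 3).subst t) ∧
      PowerSeries.map (algebraMap ℚ ℚ_[3]) ((shortModel W D.c).formalYMulCube.subst z) =
        -(V.map PadicInt.Coe.ringHom).formalXMulSq.subst (((V.map PadicInt.Coe.ringHom).formalMul 3).subst t) := by
  -- adapted VERBATIM from `ManinThreeKummerCube_holds` §A–§C, §G (this namespace)
  obtain ⟨hz0, hlog⟩ := hz
  have hc0 : D.c ≠ 0 := D.maninConstant_ne_zero_holds
  obtain ⟨c', hc'⟩ := h3c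
  -- §A arithmetic at `3`; the `3`-integral model `E♮`
  obtain ⟨ha3, hN3⟩ := lFunction_three_eq_zero_of_nine_dvd W D.isNewformOf h9
  obtain ⟨hΔ3, hc₄3⟩ := three_dvd_Δ_and_c₄_of_hasAdditiveReductionAt W
    (hasAdditiveReductionAt_three_of_lFunction_three_eq_zero W ha3 hN3)
  obtain ⟨V, hV₁, hV₂, hV₃, hVE, hEll, -, hexpint⟩ := exists_padicInt_shortModel_three W hΔ3 hc₄3
  haveI := hEll
  haveI hInt : (V.map PadicInt.Coe.ringHom).IsIntegral ℤ_[3] := V.isIntegral_map_coe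
  have han : ∀ n, a n = W.LFunction n := fun n => by
    have h := ha n; rw [D.isNewformOf.2 n] at h; exact_mod_cast h
  have hrat : ∀ q : ℚ, algebraMap ℚ ℚ_[3] q = (q : ℚ_[3]) := fun q => by rw [eq_ratCast]
  have hEa₁ : (V.map PadicInt.Coe.ringHom).a₁ = 0 := by rw [map_a₁, hV₁, map_zero]
  have hEa₂ : (V.map PadicInt.Coe.ringHom).a₂ = 0 := by rw [map_a₂, hV₂, map_zero]
  have hEa₃ : (V.map PadicInt.Coe.ringHom).a₃ = 0 := by rw [map_a₃, hV₃, map_zero]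
  have hEa₄ : (V.map PadicInt.Coe.ringHom).a₄ = ((shortModel W 1).a₄ : ℚ_[3]) := by rw [hVE, map_a₄, hrat]
  have hEa₆ : (V.map PadicInt.Coe.ringHom).a₆ = ((shortModel W 1).a₆ : ℚ_[3]) := by rw [hVE, map_a₆, hrat]
  -- §B the germ read on `E♮ ⊗ ℚ₃`
  set ι : ℚ⟦X⟧ →+* ℚ_[3]⟦X⟧ := PowerSeries.map (algebraMap ℚ ℚ_[3]) with hι
  set z₃ : ℚ_[3]⟦X⟧ := ι z with hz₃
  set L₃ : ℚ_[3]⟦X⟧ := ι (lSeriesLog a) with hL₃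
  set D₃ : ℚ_[3]⟦X⟧ := C ((D.c : ℚ) : ℚ_[3]) * z₃ with hD₃
  have hcz0 : constantCoeff (C (D.c : ℚ) * z) = 0 := by rw [map_mul, hz0, mul_zero]
  have hlog1 : (shortModel W 1).formalLog.subst (C (D.c : ℚ) * z) = C (D.c : ℚ) * lSeriesLog a := by
    have h := formalLog_shortModel_subst W hc0 hz0
    rw [hlog] at h
    have hcc : (C (D.c : ℚ) : ℚ⟦X⟧) * C (D.c : ℚ)⁻¹ = 1 := by
      rw [← map_mul, mul_inv_cancel₀ (Int.cast_ne_zero.mpr hc0), map_one]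
    calc (shortModel W 1).formalLog.subst (C (D.c : ℚ) * z)
        = C (D.c : ℚ) * C (D.c : ℚ)⁻¹ * (shortModel W 1).formalLog.subst (C (D.c : ℚ) * z) := by
          rw [hcc, one_mul]
      _ = C (D.c : ℚ) * lSeriesLog a := by rw [mul_assoc, ← h]
  have hz₃0 : constantCoeff z₃ = 0 := by
    rw [hz₃, hι, ← coeff_zero_eq_constantCoeff, coeff_map, coeff_zero_eq_constantCoeff, hz0, map_zero]
  have hD₃0 : constantCoeff D₃ = 0 := by rw [hD₃, map_mul, hz₃0, mul_zero]
  have hL₃0 : constantCoeff L₃ = 0 := by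
    rw [hL₃, hι, ← coeff_zero_eq_constantCoeff, coeff_map, lSeriesLog, coeff_mk]; simp
  have hlog2 : (V.map PadicInt.Coe.ringHom).formalLog.subst D₃ = C ((D.c : ℚ) : ℚ_[3]) * L₃ := by
    have h := congrArg ι hlog1
    rw [hι, map_subst_apply (HasSubst.of_constantCoeff_zero' hcz0), map_formalLog, ← hVE, map_mul,
      map_C, map_mul, map_C, hrat] at h
    exact h
  -- §C dividing by `3`: `D₃ = [3](t)`, `t = exp_{E♮}(c′L)` integral
  have hcc' : ((D.c : ℚ) : ℚ_[3]) = (3 : ℕ) * ((c' : ℚ) : ℚ_[3]) := by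
    rw [hc']; push_cast; ring
  set t : ℚ_[3]⟦X⟧ := (V.map PadicInt.Coe.ringHom).formalExp.subst (C ((c' : ℚ) : ℚ_[3]) * L₃) with htdef
  have hDt : D₃ = ((V.map PadicInt.Coe.ringHom).formalMul 3).subst t :=
    eq_formalMul_subst_formalExp_of_formalLog_subst' (V.map PadicInt.Coe.ringHom) 3 hD₃0 hL₃0 hcc' hlog2
  have hu0 : constantCoeff (C ((c' : ℚ) : ℚ_[3]) * L₃) = 0 := by rw [map_mul, hL₃0, mul_zero]
  have ht0 : constantCoeff t = 0 := by
    rw [htdef, Literature.RingTheory.FormalGroups.constantCoeff_subst_of_constantCoeff_eq_zero hu0,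
      constantCoeff_formalExp]
  have hL₃int : IsPadicInt L₃ := by
    rw [isPadicInt_iff_coeff]
    intro n
    rw [hL₃, hι, coeff_map, lSeriesLog, coeff_mk, hrat]
    by_cases hn0 : n = 0
    · subst hn0; simp
    by_cases h3n : 3 ∣ n
    · rw [han n, lFunction_eq_zero_of_three_dvd W ha3 hN3 hn0 h3n]
      simp
    · push_cast
      rw [div_eq_mul_inv, norm_mul, padic_norm_inv_natCast_of_not_dvd h3n, mul_one]
      exact Padic.norm_int_le_one _
  have hc'int : IsPadicInt (C ((c' : ℚ) : ℚ_[3]) : ℚ_[3]⟦X⟧) := by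
    rw [Rat.cast_intCast]
    exact IsPadicInt.powerSeries_C (Padic.norm_int_le_one _)
  have htint : IsPadicInt t :=
    hexpint.powerSeries_subst (hc'int.mul hL₃int) (HasSubst.of_constantCoeff_zero' hu0)
  have hL₃1 : coeff 1 L₃ = 1 := by
    rw [hL₃, hι, coeff_map, lSeriesLog, coeff_mk, hrat, han 1, W.isMultiplicative_LFunction.map_one]
    simp
  have hD₃ne : D₃ ≠ 0 := by
    intro h0
    have hsub0 : (V.map PadicInt.Coe.ringHom).formalLog.subst (0 : ℚ_[3]⟦X⟧) = 0 := by
      rw [subst_zero_eq_C_constantCoeff, constantCoeff_formalLog, map_zero, map_zero]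
    have h := hlog2
    rw [h0, hsub0] at h
    have h1 := congrArg (coeff 1) h
    rw [map_zero, coeff_C_mul, hL₃1, mul_one] at h1
    exact hc0 (by exact_mod_cast h1.symm)
  have hDne : ((V.map PadicInt.Coe.ringHom).formalMul 3).subst t ≠ 0 := hDt ▸ hD₃ne
  have htne : t ≠ 0 := fun h0 => hDne <| by
    rw [h0, subst_zero_eq_C_constantCoeff, constantCoeff_formalMul, map_zero, map_zero]
  -- §G the two `T`-free transports
  have hzs : HasSubst z := HasSubst.of_constantCoeff_zero' hz0
  have hXc : ι ((shortModel W D.c).formalXMulSq.subst z) = (V.map PadicInt.Coe.ringHom).formalXMulSq.subst D₃ := by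
    rw [formalXMulSq_shortModel_subst W hc0 hz0, hι,
      map_subst_apply (HasSubst.of_constantCoeff_zero' hcz0), map_formalXMulSq, ← hVE, map_mul, map_C, hrat]
  have hYc : ι ((shortModel W D.c).formalYMulCube.subst z) = -(V.map PadicInt.Coe.ringHom).formalXMulSq.subst D₃ := by
    have hY : (shortModel W D.c).formalYMulCube = -(shortModel W D.c).formalXMulSq := rfl
    rw [hY, ← coe_substAlgHom hzs, map_neg, coe_substAlgHom hzs, map_neg, hXc]
  refine ⟨V, hEll, t, hEa₁, hEa₂, hEa₃, hEa₄, hEa₆, ht0, htne, htint, hDne, ?_, ?_, ?_⟩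
  · rw [← hDt]
  · rw [← hDt]; exact hXc
  · rw [← hDt]; exact hYc

end Summit.BirchSwinnertonDyer.BirchSwinnertonDyer.Theorems.ManinLocalTwoThree.KLineBI

end
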